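import Summits.CriticalPhenomena.PercolationContinuityZ3.Theorems.PercNearOneGluingNoHeavyLowerTailSahiSlotTensorCone

/-!
# "ALL BUT TWO MEMBERS PINNED": the bilinear (pivotal-pair) certificate format for the slot functional at every order

Support file of the one-cut programme (crux `NoHeavyLowerTail`, stmt-CriticalPhenomena-4575; cell `prim-masterthm`, seat P3, gen 21;
`run/shared/lean/prim/prim-masterthm/prim-masterthm-p3/HIERARCHY.md` §29, memo `FROM-prim-masterthm-p3-g21-PINNED-CERTIFICATES.md` §4).

THE FORMAT.  At order `n + 2` in dimension `d`, PIN the first `n` members (arbitrary up-sets `A_0, …, A_{n-1}` of the slot cube, known exactly)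
and ask that the remaining BILINEAR form `(B, C) ↦ patternForm d (n+2) (1_{A_0}, …, 1_{A_{n-1}}, 1_B, 1_C)` be a nonnegative combination of
products `ℓ(1_B) · ℓ'(1_C)` of monotonicity literals (`SahiSlot.Lit`: `x_⊥`, `1 − x_⊤`, cut edges `x_{p+e_a} − x_p`) — `SahiSlot.PairLitCert d n`.
At order 2 (`n = 0`) this is the global literal-product certificate of gen 20 restricted to two members (`LitProdCert d 2`, closed form for every
`d`, memo g20 §2); at order 3 (`n = 1`) it is the pinned one-member format (`PinnedLitCert d 2` of …SahiSlotPinnedCert).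
EVIDENCE (gen-21 LPs, memo §3–§4; none of it is claimed in this file): order 3 — all 980 up-sets of `[3]^3` (exact rational certificates),
760 random up-sets of `[3]^4`; Boolean normal form — every up-set of `{0,1}^m`, `m ≤ 5`, product measures, and `m ≤ 4`
under random FKG measures; ORDER 4 with two members pinned — all 190 pairs of up-sets of `{0,1}^3` (product and FKG), random pairs in `[4]^3`;
ORDER 5 with three pinned — all 1330 triples of up-sets of `{0,1}^3`; whereas pinning only `n − 3` members FAILS already at order 4 on `{0,1}^3`.
CONJECTURE (PIVOTAL-PAIR, gen 21): `PairLitCert d n` for all `d, n` — by `slotPatternPos_of_pairLitCert` it implies `SlotPatternPos d (n+2)` for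
all `d, n`, hence Sahi's `C_n` for every product measure on every product of chains (`sahiConjecture_of_forall_slotPatternPos`).
THIS FILE (pure, standard axioms): the definition and its soundness. HONEST LABEL: a certificate FORMAT; no cell changes status. [this work]
-/

namespace Summit.CriticalPhenomena.PercolationContinuityZ3.Theorems

open Finset Function
open Literature.Combinatorics.Sahi2008

namespace SahiSlot

section Pair

variable {d n : ℕ}

/-- The member family with the first `n` members `A`, then `B`, then `C` (order `n + 2`). [this work] -/
def pairFam (A : Fin n → Q d (n + 2) → ℝ) (B C : Q d (n + 2) → ℝ) : Fin (n + 2) → Q d (n + 2) → ℝ :=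
  Fin.snoc (Fin.snoc A B) C

/-- Every family of `n + 2` members is a `pairFam` of its first `n` members and its last two. [this work] -/
theorem pairFam_init (h : Fin (n + 2) → Q d (n + 2) → ℝ) :
    pairFam (Fin.init (Fin.init h)) (h (Fin.last n).castSucc) (h (Fin.last (n + 1))) = h := by
  unfold pairFam
  have h1 : Fin.snoc (Fin.init (Fin.init h)) (h (Fin.last n).castSucc) = Fin.init h := by
    conv_rhs => rw [← Fin.snoc_init_self (Fin.init h)]
    rfl
  rw [h1, Fin.snoc_init_self]

/-- **"All but two pinned" (pivotal-pair) certificate** at order `n + 2` in dimension `d`: for every `n`-tuple of up-sets `A` (pinned, known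
exactly) there are finitely many PAIRS of literals with nonnegative coefficients (depending on `A`) whose products sum to
`patternForm d (n+2) (1_{A_0},…,1_{A_{n-1}}, 1_B, 1_C)` for all up-sets `B, C`. [this work] [status: conjectured for all `d, n`; LP evidence memo g21] -/
def PairLitCert (d n : ℕ) : Prop :=
  ∀ A : Fin n → Finset (Q d (n + 2)), (∀ i, IsUpperSet ((A i : Finset (Q d (n + 2))) : Set (Q d (n + 2)))) →
    ∃ (k : ℕ) (coef : Fin k → ℝ) (J J' : Fin k → Lit d (n + 2)), (∀ j, 0 ≤ coef j) ∧
      ∀ B C : Finset (Q d (n + 2)), IsUpperSet ((B : Finset (Q d (n + 2))) : Set (Q d (n + 2))) →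
        IsUpperSet ((C : Finset (Q d (n + 2))) : Set (Q d (n + 2))) →
          patternForm d (n + 2) (pairFam (fun i => setInd (A i)) (setInd B) (setInd C)) =
            ∑ j, coef j * ((J j).eval (setInd B) * (J' j).eval (setInd C))

/-- **Soundness**: an all-but-two-pinned certificate proves the cell `SlotPatternPos d (n+2)`. [this work] -/
theorem slotPatternPos_of_pairLitCert (h : PairLitCert d n) : SlotPatternPos d (n + 2) := by
  intro U hU
  obtain ⟨k, coef, J, J', hcoef, hid⟩ := h (fun i => U i.castSucc.castSucc) fun i => hU _
  have hfam : (fun i => setInd (U i)) =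
      pairFam (fun i : Fin n => setInd (U i.castSucc.castSucc)) (setInd (U (Fin.last n).castSucc)) (setInd (U (Fin.last (n + 1)))) := by
    rw [← pairFam_init (fun i => setInd (U i))]
    rfl
  rw [hfam, hid _ _ (hU _) (hU _)]
  exact sum_nonneg fun j _ => mul_nonneg (hcoef j)
    (mul_nonneg (Lit.eval_setInd_nonneg _ (hU _) _) (Lit.eval_setInd_nonneg _ (hU _) _))

end Pair

end SahiSlot

end Summit.CriticalPhenomena.PercolationContinuityZ3.Theorems
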